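import Summits.CriticalPhenomena.SAWScalingLimit.Theorems.SAWLoopFugacityFlowSimpleSubseqLimitsFarReturnPassage
import Summits.CriticalPhenomena.SAWScalingLimit.Theorems.SAWLoopFugacityFlowSimpleSubseqLimitsPastsCompact
import HarnessLib

/-!
# Line `slit-continuous-restriction` — the soft transfer, part 2: the squeeze configuration
# (crux stmt-CriticalPhenomena-4982, decl
# `Summit.CriticalPhenomena.SAWScalingLimit.Theses.SAWLoopFugacityFlow.SimpleSubseqLimits`;
# registered skeleton `Cruxes/SimpleSubseqLimits/Lines/slit_continuous_restriction.lean`)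

Second file toward the registered stub `stub_transferCore` (lead c9). The OPEN event through which
the transfer passes from the limit measure `ν` to the lattice laws is the **squeeze configuration**
`Conf q ρ ρ₀ R ε N γ`: times `v ≤ τa ≤ τb ≤ t'` such that the curve is `ρ`-far from `q` on
`[0, τa]`, `ρ₀`-close at `τb` (so every hitting time of the closed ball `B̄(q, ρ)` by a polyline
vertex lies in `(τa, τb]`), `R`-far on `[0, v]` (guard), `γ t'` is `ε`-close to `γ v` (a near
return to the far past), and — the conditional part — EVERY truncation `γ|[0, w]` at a time
`w ∈ [τa, τb]` at which the curve is `ρ₂`-close to `q` (for some `ρ₂ > ρ`) has its class in the open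
set `N` (the union of the cover neighbourhoods of the finitely many admissible pasts).

* `isOpen_setOf_conf` — `Conf` is OPEN for the reparametrisation pseudo-metric: besides the usual
  uniform slacks (`FarPast.Passage.exists_slack_Iic`), the truncation clause is protected by a
  compactness margin: the classes of the truncations at the compact set of times
  `{w ∈ [τa, τb] | dist (γ w) q ≤ (ρ + ρ₂)/2}` form a compact subset of `N`
  (`Pasts.continuous_truncate`), hence have a positive thickening inside `N`
  (`IsCompact.exists_thickening_subset_open`), and truncations transport under reparametrisation
  closeness with no loss modulo reparametrisation (`Pasts.mk_truncate_reparam`, `Pasts.dist_truncate_le`).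
* `conf_of_return` — a curve with a far-return structure at `B̄(q, r)` whose truncations before the
  first hit of `B̄(q, ρ₁)` have classes in `N` lies in `Conf` (`FirstHitFlat.exists_firstHit`,
  `FarPast.Passage.le_dist_of_firstHit`).
-/

noncomputable section

open MeasureTheory Filter Topology Set Metric Function
open Literature.Probability.RandomPlanarGeometry
open scoped ENNReal NNReal unitInterval

namespace Summit.CriticalPhenomena.SAWScalingLimit.Theorems.SimpleSubseqLimits.SlitRestriction.Transfer

open Summit.CriticalPhenomena.SAWScalingLimit.Theorems.SimpleSubseqLimits.SlitRestriction.Pasts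
  (truncate dist_truncate_le mk_truncate_reparam continuous_truncate)
open Summit.CriticalPhenomena.SAWScalingLimit.Theorems.SimpleSubseqLimits.FarPast.Passage
  (exists_slack_Iic le_dist_of_firstHit)
open Summit.CriticalPhenomena.SAWScalingLimit.Theorems.SimpleSubseqLimits.FirstHitFlat (exists_firstHit)

/-! ## The squeeze configuration -/

/-- **Squeeze configuration** of a curve `γ` at the ball `B̄(q, ρ)` with depth radius `ρ₀ < ρ`, guard
`R`, return width `ε` and past-neighbourhood `N`: times `v ≤ τa ≤ τb ≤ t'` and a margin `ρ₂ > ρ` such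
that `γ` is `ρ`-far from `q` on `[0, τa]`, `ρ₀`-close at `τb`, `R`-far on `[0, v]`, returns at `t'`
to within `ε` of `γ v`, and every truncation `γ|[0, w]`, `w ∈ [τa, τb]`, taken while `ρ₂`-close to
`q`, has its class in `N`. [folklore] -/
def Conf (q : ℂ) (ρ ρ₀ R ε : ℝ) (N : Set (CurveClass ℂ)) (γ : Curve ℂ) : Prop :=
  ∃ v τa τb t' : I, v ≤ τa ∧ τa ≤ τb ∧ τb ≤ t' ∧ ∃ ρ₂ : ℝ, ρ < ρ₂ ∧
    (∀ u : I, u ≤ τa → ρ < dist (γ u) q) ∧ dist (γ τb) q < ρ₀ ∧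
    (∀ u : I, u ≤ v → R < dist (γ u) q) ∧ dist (γ t') (γ v) < ε ∧
    ∀ w : I, τa ≤ w → w ≤ τb → dist (γ w) q < ρ₂ → CurveClass.mk (truncate γ w) ∈ N

/-- Six positive quantities admit a common positive strict lower margin. [folklore] -/
theorem exists_pos_lt_six {x₁ x₂ x₃ x₄ x₅ x₆ : ℝ} (h₁ : 0 < x₁) (h₂ : 0 < x₂) (h₃ : 0 < x₃)
    (h₄ : 0 < x₄) (h₅ : 0 < x₅) (h₆ : 0 < x₆) :
    ∃ d : ℝ, 0 < d ∧ d < x₁ ∧ d < x₂ ∧ d < x₃ ∧ d < x₄ ∧ d < x₅ ∧ d < x₆ := by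
  set m := min (min (min x₁ x₂) (min x₃ x₄)) (min x₅ x₆) with hm
  have hmpos : 0 < m := lt_min (lt_min (lt_min h₁ h₂) (lt_min h₃ h₄)) (lt_min h₅ h₆)
  have hlt : m / 2 < m := half_lt_self hmpos
  refine ⟨m / 2, half_pos hmpos, ?_, ?_, ?_, ?_, ?_, ?_⟩
  · exact hlt.trans_le ((min_le_left _ _).trans ((min_le_left _ _).trans (min_le_left _ _)))
  · exact hlt.trans_le ((min_le_left _ _).trans ((min_le_left _ _).trans (min_le_right _ _)))
  · exact hlt.trans_le ((min_le_left _ _).trans ((min_le_right _ _).trans (min_le_left _ _)))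
  · exact hlt.trans_le ((min_le_left _ _).trans ((min_le_right _ _).trans (min_le_right _ _)))
  · exact hlt.trans_le ((min_le_right _ _).trans (min_le_left _ _))
  · exact hlt.trans_le ((min_le_right _ _).trans (min_le_right _ _))

/-- **The squeeze configuration is open** in `Curve ℂ` (for an open past-neighbourhood `N`).
[folklore] -/
theorem isOpen_setOf_conf : ∀ (q : ℂ) (ρ ρ₀ R ε : ℝ) (N : Set (CurveClass ℂ)), IsOpen N →
    IsOpen {γ : Curve ℂ | Conf q ρ ρ₀ R ε N γ} := by
  intro q ρ ρ₀ R ε N hN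
  rw [Metric.isOpen_iff]
  rintro γ ⟨v, τa, τb, t', hvτa, hτab, hτbt, ρ₂, hρ₂, hfarτa, hτb, hguard, hret, hclause⟩
  obtain ⟨m₁, hm₁, hmin₁⟩ := exists_slack_Iic γ q hfarτa
  obtain ⟨m₂, hm₂, hmin₂⟩ := exists_slack_Iic γ q hguard
  -- compactness margin for the truncation clause
  set ρ₂' : ℝ := (ρ + ρ₂) / 2 with hρ₂'
  have hρ₂'lt : ρ₂' < ρ₂ := by rw [hρ₂']; linarith
  set W : Set I := Icc τa τb ∩ {w | dist (γ w) q ≤ ρ₂'} with hW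
  have hWc : IsCompact W :=
    (isClosed_Icc.inter (isClosed_le (γ.continuous.dist continuous_const) continuous_const)).isCompact
  set S : Set (CurveClass ℂ) := (fun w : I => CurveClass.mk (truncate γ w)) '' W with hS
  have hSc : IsCompact S := hWc.image (CurveClass.continuous_mk.comp (continuous_truncate γ))
  have hSN : S ⊆ N := by
    rintro _ ⟨w, ⟨⟨hw1, hw2⟩, hw3⟩, rfl⟩
    exact hclause w hw1 hw2 (hw3.trans_lt hρ₂'lt)
  obtain ⟨κ₀, hκ₀, hthick⟩ := hSc.exists_thickening_subset_open hN hSN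
  obtain ⟨d, hd0, hd1, hd2, hd3, hd4, hd5, hd6⟩ := exists_pos_lt_six (sub_pos.2 hm₁) (sub_pos.2 hτb)
    (sub_pos.2 hm₂) (half_pos (sub_pos.2 hret)) (half_pos (sub_pos.2 hρ₂)) hκ₀
  refine ⟨d, hd0, fun γ' hγ' => ?_⟩
  rw [Metric.mem_ball, dist_comm] at hγ'
  obtain ⟨φ, hφ⟩ := Curve.exists_dist_reparam_lt hγ'
  have hcl : ∀ u, dist (γ u) (γ' (φ u)) < d := fun u => by
    have h := ContinuousMap.dist_apply_le_dist (f := γ.toContinuousMap)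
      (g := (γ'.reparam φ).toContinuousMap) (x := u)
    simp only [Curve.coe_toContinuousMap, Curve.reparam_apply] at h
    exact h.trans_lt hφ
  have hcl' : ∀ u', dist (γ (φ.symm u')) (γ' u') < d := fun u' => by
    simpa only [OrderIso.apply_symm_apply] using hcl (φ.symm u')
  refine ⟨φ v, φ τa, φ τb, φ t', φ.monotone hvτa, φ.monotone hτab, φ.monotone hτbt, ρ₂' - d,
    by rw [hρ₂']; linarith, ?_, ?_, ?_, ?_, ?_⟩
  · -- `ρ`-far on `[0, φ τa]`
    intro u' hu'
    have hle : φ.symm u' ≤ τa := φ.symm_apply_le.2 hu'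
    have h₁ := hmin₁ (φ.symm u') hle
    have h₂ := dist_triangle (γ (φ.symm u')) (γ' u') q
    have h₃ := hcl' u'
    linarith
  · -- `ρ₀`-close at `φ τb`
    have h₁ := dist_triangle (γ' (φ τb)) (γ τb) q
    have h₂ := hcl τb
    rw [dist_comm] at h₂
    linarith
  · -- guard on `[0, φ v]`
    intro u' hu'
    have hle : φ.symm u' ≤ v := φ.symm_apply_le.2 hu'
    have h₁ := hmin₂ (φ.symm u') hle
    have h₂ := dist_triangle (γ (φ.symm u')) (γ' u') q
    have h₃ := hcl' u'
    linarith
  · -- the near return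
    have h₁ := dist_triangle4 (γ' (φ t')) (γ t') (γ v) (γ' (φ v))
    have h₂ := hcl t'
    have h₃ := hcl v
    rw [dist_comm] at h₂
    linarith
  · -- the truncation clause, with margin `ρ₂' - d`
    intro w' hw'a hw'b hdist
    set w : I := φ.symm w' with hw
    have hw' : φ w = w' := φ.apply_symm_apply w'
    have hwa : τa ≤ w := φ.le_symm_apply.2 hw'a
    have hwb : w ≤ τb := φ.symm_apply_le.2 hw'b
    have hwdist : dist (γ w) q ≤ ρ₂' := by
      have h₁ := dist_triangle (γ w) (γ' w') q
      have h₂ := hcl' w'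
      rw [← hw] at h₂
      linarith
    have hmemS : CurveClass.mk (truncate γ w) ∈ S := ⟨w, ⟨⟨hwa, hwb⟩, hwdist⟩, rfl⟩
    refine hthick (mem_thickening_iff.2 ⟨_, hmemS, ?_⟩)
    have hrep : CurveClass.mk (truncate γ' w') = CurveClass.mk (truncate (γ'.reparam φ) w) := by
      rw [← hw', mk_truncate_reparam]
    rw [hrep, CurveClass.dist_mk_mk]
    refine (dist_truncate_le (fun u => ?_) w).trans_lt hd6
    rw [Curve.reparam_apply, dist_comm]
    exact (hcl u).le

/-! ## Far-return curves lie in the squeeze configuration -/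

/-- **A far return is a squeeze configuration** as soon as its truncations before the first hit of
an intermediate closed ball have classes in `N`: for radii `r < ρ₁ < ρ₀ ≤ ρ < 5r`, guard `R < 5r`,
width `ε > 0` and margin `κ > 0`, a curve with `T ≤ t'`, `γ T ∈ B̄(q, r)`, `γ [0, v]` outside
`B̄(q, 5r)` and `γ t' = γ v` lies in `Conf q ρ ρ₀ R ε N` provided every truncation `γ|[0, w]`,
`v ≤ w ≤ T`, with `dist (γ w) q < ρ + κ` and `γ [0, w]` outside the open ball `B(q, ρ₁)`, has
class in `N` (witnesses: `τa = v`, `τb` = the first hit of `B̄(q, ρ₁)`, `ρ₂ = ρ + κ`; `v < T` follows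
from the guard). [folklore] -/
theorem conf_of_return {γ : Curve ℂ} {q : ℂ} {r ρ₁ ρ₀ ρ R ε κ : ℝ} {N : Set (CurveClass ℂ)}
    {v T t' : I} (hTt : T ≤ t') (hT : γ T ∈ closedBall q r)
    (hguard : ∀ u : I, u ≤ v → 5 * r < dist (γ u) q) (hret : γ t' = γ v) (hr : r < ρ₁)
    (hρ₁ : ρ₁ < ρ₀) (hρ₀ : ρ₀ ≤ ρ) (hρ : ρ < 5 * r) (hR : R < 5 * r) (hε : 0 < ε) (hκ : 0 < κ)
    (hN : ∀ w : I, v ≤ w → w ≤ T → dist (γ w) q < ρ + κ →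
      (∀ u : I, u ≤ w → ρ₁ ≤ dist (γ u) q) → CurveClass.mk (truncate γ w) ∈ N) :
    Conf q ρ ρ₀ R ε N γ := by
  have hT' : γ T ∈ closedBall q ρ₁ := closedBall_subset_closedBall hr.le hT
  obtain ⟨τb, hτbT, hτb, hfirst⟩ := exists_firstHit γ isClosed_closedBall hT'
  have hvτb : v < τb := by
    refine lt_of_not_ge fun hle => ?_
    have h := hguard τb hle
    rw [mem_closedBall] at hτb
    linarith
  refine ⟨v, v, τb, t', le_rfl, hvτb.le, hτbT.trans hTt, ρ + κ, by linarith, ?_, ?_, ?_, ?_, ?_⟩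
  · intro u hu
    have h := hguard u hu
    linarith
  · rw [mem_closedBall] at hτb
    exact hτb.trans_lt hρ₁
  · intro u hu
    have h := hguard u hu
    linarith
  · rw [hret, dist_self]
    exact hε
  · intro w hvw hwτb hdist
    refine hN w hvw (hwτb.trans hτbT) hdist fun u hu => ?_
    rcases (hu.trans hwτb).lt_or_eq with hlt | heq
    · have h := hfirst u hlt
      rw [mem_closedBall, not_le] at h
      exact h.le
    · rw [heq]
      exact le_dist_of_firstHit hvτb hfirst

end Summit.CriticalPhenomena.SAWScalingLimit.Theorems.SimpleSubseqLimits.SlitRestriction.Transfer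

end
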